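import Mathlib
import HarnessLib
import Summits.HubbardSuperconductivity.HubbardSuperconductivity.Theorems.KLProgrammeKLRegimeCountertermJacksonRemainderCert
import Summits.HubbardSuperconductivity.HubbardSuperconductivity.Theorems.KLProgrammeKLRegimeCountertermJacksonRemainderCertFrameDefs

/-!
# Route `KLProgramme`, crux K3 — gen-8 ENGINE-FLOW child (stmt-HubbardSuperconductivity-20437 `KLRegimeEngineV17F2`), stub (C)
# `stub_twoLeg_curvature`: the (C1) certificate consumer — MAJORANT form and the FRAME-QUANTIFIED certificate

Seat hubbard-kl-k3c3-p1 (g7).  §1 `flowPiece_reading_remainder_jets_of_majorants`: the assembly of `…JacksonRemainderCert` with the certificate's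
existential block (majorants of the 27 products at level `μ` for the frame's own radius) taken as a HYPOTHESIS at the base angle — the common core
of both certificate forms.  §2 **`flowPiece_reading_remainder_jets_of_certFrame`**: from the frame-quantified named numerical hypothesis
`CutoffDefectCertFrame d A T` (`…CertFrameDefs`) and frame sizes `‖Dʲ(evalM K′)‖ ≤ A j` (`j ≤ 4`), the on-curve identity and the regularity of
`u_{K′}`: `|∂ᵏ[ν_n(K_n) − (klFlowPiece n).eval∘k_F^{K′}](θ)| ≤ T.bound a k` (`1 ≤ k ≤ 4`, every `θ`) — no polar-jet perturbation lemma needed.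
Pure assembly; no definitions; nothing here asserts superconductivity.
-/

noncomputable section

namespace Summit.HubbardSuperconductivity.HubbardSuperconductivity.Theorems.KLRegimeSplit

set_option linter.dupNamespace false -- summit = problem name (single-conjunct summit), D-0017

open Real MeasureTheory Filter Set
open scoped Topology
open Literature.Analysis.Fourier.TrigApprox Literature.MathematicalPhysics.QuantumLattice
open Summit.HubbardSuperconductivity.HubbardSuperconductivity.Theorems.PerturbedFermiCurve

/-! ## §1 The majorant form at one base angle -/

section Majorants

variable {L M : ℕ} [NeZero L] [NeZero M]

/-- **Jets of the Jackson remainder from certificate majorants at one base angle** (the assembly core). -/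
theorem flowPiece_reading_remainder_jets_of_majorants (T : CutoffDefectTable) (β U : ℝ) {μ : ℝ} (hμ : μ ∈ klWindowC) (n : ℕ) (K' : TrigPolyC4v)
    (hf : ContDiff ℝ 5 fun θ : ℝ => klLocalPart L M β U μ (klFlowFrameU L M β U μ n) n θ)
    (hon : ∀ θ, klFrameExtFn μ (fun θ => klLocalPart L M β U μ (klFlowFrameU L M β U μ n) n θ) (klFermiPoint μ K' θ) =
      klLocalPart L M β U μ (klFlowFrameU L M β U μ n) n θ)
    (hang : ∀ θ, klLocalPart L M β U μ (klFlowFrameU L M β U μ n) n (polarAngle (centredRep (klFermiPoint μ K' θ))) =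
      klLocalPart L M β U μ (klFlowFrameU L M β U μ n) n θ)
    {a : ℕ → ℝ} (ha_nn : ∀ l, 0 ≤ a l)
    (ha0 : ∀ x, |klLocalPart L M β U μ (klFlowFrameU L M β U μ n) n x -
      klAngularMean (fun θ => klLocalPart L M β U μ (klFlowFrameU L M β U μ n) n θ)| ≤ a 0)
    (ha : ∀ l, 1 ≤ l → l ≤ 5 → ∀ x, |iteratedDeriv l (fun x => klLocalPart L M β U μ (klFlowFrameU L M β U μ n) n x -
      klAngularMean (fun θ => klLocalPart L M β U μ (klFlowFrameU L M β U μ n) n θ)) x| ≤ a l)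
    (hr : ContDiff ℝ 4 (perturbedFermiRadius (fun p => -K'.eval p) μ))
    (hflat : ∀ ϑ : ℝ, klFlatCutoffFn μ (klFermiPoint μ K' ϑ) = 1)
    {k : ℕ} (hk1 : 1 ≤ k) (hk : k ≤ 4) (θ : ℝ)
    (hex : ∃ (nq : ℕ → ℝ × ℝ → ℝ) (mq : ℕ → ℕ → ℕ → ℝ × ℝ → ℝ) (tq : ℕ → ℕ → ℝ × ℝ → ℝ) (uq : ℕ → ℝ × ℝ → ℝ) (dq : ℝ × ℝ → ℝ),
      (∀ i, Integrable (fun w => jweight (klFlowDeg n) w * nq i w) jmeas) ∧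
      (∀ k i l, Integrable (fun w => jweight (klFlowDeg n) w * mq k i l w) jmeas) ∧
      (∀ k l, Integrable (fun w => jweight (klFlowDeg n) w * tq k l w) jmeas) ∧
      (∀ k, Integrable (fun w => jweight (klFlowDeg n) w * uq k w) jmeas) ∧
      Integrable (fun w => jweight (klFlowDeg n) w * dq w) jmeas ∧
      (∀ᵐ w ∂jmeas,
        |certCutoff μ (perturbedFermiRadius (fun p => -K'.eval p) μ) w θ - 1| ≤ nq 0 w ∧
        (∀ i, 1 ≤ i → i ≤ 4 → |iteratedDeriv i (certCutoff μ (perturbedFermiRadius (fun p => -K'.eval p) μ) w) θ| ≤ nq i w) ∧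
        (∀ k i l, 1 ≤ i → i < k → k ≤ 4 → 1 ≤ l → l ≤ k - i →
          |iteratedDeriv i (certCutoff μ (perturbedFermiRadius (fun p => -K'.eval p) μ) w) θ| *
            bellP (k - i) l (certAngleJets (perturbedFermiRadius (fun p => -K'.eval p) μ) w θ) ≤ mq k i l w) ∧
        (∀ k l, 1 ≤ l → l < k → k ≤ 4 →
          |certCutoff μ (perturbedFermiRadius (fun p => -K'.eval p) μ) w θ| *
            bellP k l (certAngleJets (perturbedFermiRadius (fun p => -K'.eval p) μ) w θ) ≤ tq k l w) ∧
        (∀ k, 1 ≤ k → k ≤ 4 →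
          |certCutoff μ (perturbedFermiRadius (fun p => -K'.eval p) μ) w θ| *
            |iteratedDeriv 1 (certAngle (perturbedFermiRadius (fun p => -K'.eval p) μ) w) θ ^ k - 1| ≤ uq k w) ∧
        |certCutoff μ (perturbedFermiRadius (fun p => -K'.eval p) μ) w θ| *
          |toIocMod Real.two_pi_pos (-π) (certAngle (perturbedFermiRadius (fun p => -K'.eval p) μ) w θ - θ)| ≤ dq w) ∧
      (∫ w, jweight (klFlowDeg n) w * nq 0 w ∂jmeas ≤ T.N0) ∧
      (∀ i, 1 ≤ i → i ≤ 4 → ∫ w, jweight (klFlowDeg n) w * nq i w ∂jmeas ≤ T.N i) ∧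
      (∀ k i l, 1 ≤ i → i < k → k ≤ 4 → 1 ≤ l → l ≤ k - i → ∫ w, jweight (klFlowDeg n) w * mq k i l w ∂jmeas ≤ T.Mc k i l) ∧
      (∀ k l, 1 ≤ l → l < k → k ≤ 4 → ∫ w, jweight (klFlowDeg n) w * tq k l w ∂jmeas ≤ T.Tt k l) ∧
      (∀ k, 1 ≤ k → k ≤ 4 → ∫ w, jweight (klFlowDeg n) w * uq k w ∂jmeas ≤ T.Tu k) ∧
      (∫ w, jweight (klFlowDeg n) w * dq w ∂jmeas ≤ T.Td)) :
    |iteratedDeriv k (fun θ => klLocalPart L M β U μ (klFlowFrameU L M β U μ n) n θ -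
        (klFlowPiece L M β U μ n).eval (klFermiPoint μ K' θ)) θ| ≤ T.bound a k := by
  set f : ℝ → ℝ := fun θ => klLocalPart L M β U μ (klFlowFrameU L M β U μ n) n θ with hfdef
  set m : ℝ := klAngularMean f with hmdef
  set g : ℝ → ℝ := fun x => f x - m with hgdef
  set r : ℝ → ℝ := perturbedFermiRadius (fun p => -K'.eval p) μ with hrdef
  have hper : Function.Periodic f (2 * Real.pi) := klLocalPart_periodic β U μ _ n
  have hgper : Function.Periodic g (2 * Real.pi) := fun x => by simp only [hgdef, hper x]
  have hg5 : ContDiff ℝ 5 g := hf.sub contDiff_const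
  have hf4 : ContDiff ℝ 4 f := hf.of_le (by norm_num)
  have hγ : ContDiff ℝ 4 fun θ => (WithLp.toLp 2 (klFermiPoint μ K' θ) : EuclideanSpace ℝ (Fin 2)) := contDiff_certCurve hr
  obtain ⟨nq, mq, tq, uq, dq, hin, him, hit, hiu, hid, hae, hN0, hN, hMc, hTt, hTu, hTd⟩ := hex
  -- the a.e. chain bounds of the displaced angular factor
  have hchain := ae_jmeas_chain_bounds_certAngle hr hg5 hgper ha θ
  -- majorants
  set pdef : ℕ → ℝ × ℝ → ℝ := fun i w => (if i = k then a 0 * nq i w else 0) + ∑ l ∈ Finset.Icc 1 (k - i), a l * mq k i l w with hpdef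
  set tdef : ℝ × ℝ → ℝ := fun w => (∑ l ∈ Finset.Ico 1 k, a l * tq k l w) + a k * uq k w + a (k + 1) * dq w with htdef
  set edef : ℝ × ℝ → ℝ := fun w => a k * nq 0 w with hedef
  -- integrability
  have epdef : ∀ i w, jweight (klFlowDeg n) w * pdef i w =
      (if i = k then a 0 * (jweight (klFlowDeg n) w * nq i w) else 0) +
        ∑ l ∈ Finset.Icc 1 (k - i), a l * (jweight (klFlowDeg n) w * mq k i l w) := by
    intro i w
    by_cases hieq : i = k
    · simp only [hpdef, hieq, if_true, mul_add, Finset.mul_sum]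
      congr 1
      · ring
      · exact Finset.sum_congr rfl fun l _ => by ring
    · simp only [hpdef, hieq, if_false, zero_add, Finset.mul_sum]
      exact Finset.sum_congr rfl fun l _ => by ring
  have hpint : ∀ i, 1 ≤ i → i ≤ k → Integrable (fun w => jweight (klFlowDeg n) w * pdef i w) jmeas := by
    intro i hi1 hik
    have e : (fun w => jweight (klFlowDeg n) w * pdef i w) =
        fun w => (if i = k then a 0 * (jweight (klFlowDeg n) w * nq i w) else 0) +
          ∑ l ∈ Finset.Icc 1 (k - i), a l * (jweight (klFlowDeg n) w * mq k i l w) := funext (epdef i)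
    rw [e]
    refine Integrable.add ?_ (integrable_finsetSum _ fun l _ => (him k i l).const_mul _)
    by_cases hieq : i = k
    · simp only [hieq, if_true]; exact (hin k).const_mul _
    · simp only [hieq, if_false]; exact integrable_zero _ _ _
  have htint : Integrable (fun w => jweight (klFlowDeg n) w * tdef w) jmeas := by
    have e : (fun w => jweight (klFlowDeg n) w * tdef w) =
        fun w => (∑ l ∈ Finset.Ico 1 k, a l * (jweight (klFlowDeg n) w * tq k l w)) + a k * (jweight (klFlowDeg n) w * uq k w) +
          a (k + 1) * (jweight (klFlowDeg n) w * dq w) := by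
      funext w; simp only [htdef, mul_add, Finset.mul_sum]; ring_nf
    rw [e]
    exact ((integrable_finsetSum _ fun l _ => (hit k l).const_mul _).add ((hiu k).const_mul _)).add (hid.const_mul _)
  have heint : Integrable (fun w => jweight (klFlowDeg n) w * edef w) jmeas := by
    have e : (fun w => jweight (klFlowDeg n) w * edef w) = fun w => a k * (jweight (klFlowDeg n) w * nq 0 w) := by
      funext w; simp only [hedef]; ring
    rw [e]; exact (hin 0).const_mul _
  -- moments
  have hMx : ∀ i, 1 ≤ i → i ≤ k → ∫ w, jweight (klFlowDeg n) w * pdef i w ∂jmeas ≤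
      (if i = k then a 0 * T.N i else 0) + ∑ l ∈ Finset.Icc 1 (k - i), a l * T.Mc k i l := by
    intro i hi1 hik
    have hsum : ∫ w, ∑ l ∈ Finset.Icc 1 (k - i), a l * (jweight (klFlowDeg n) w * mq k i l w) ∂jmeas ≤
        ∑ l ∈ Finset.Icc 1 (k - i), a l * T.Mc k i l := by
      rw [integral_finsetSum _ fun l _ => (him k i l).const_mul _]
      refine Finset.sum_le_sum fun l hl => ?_
      rw [integral_const_mul]
      simp only [Finset.mem_Icc] at hl
      have hlt : i < k := by omega
      exact mul_le_mul_of_nonneg_left (hMc k i l hi1 hlt hk hl.1 hl.2) (ha_nn l)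
    have i2 : Integrable (fun w => ∑ l ∈ Finset.Icc 1 (k - i), a l * (jweight (klFlowDeg n) w * mq k i l w)) jmeas :=
      integrable_finsetSum _ fun l _ => (him k i l).const_mul _
    by_cases hieq : i = k
    · have e : (fun w => jweight (klFlowDeg n) w * pdef i w) =
          fun w => a 0 * (jweight (klFlowDeg n) w * nq i w) + ∑ l ∈ Finset.Icc 1 (k - i), a l * (jweight (klFlowDeg n) w * mq k i l w) := by
        funext w; rw [epdef i w]; simp only [hieq, if_true]
      have i1 : Integrable (fun w => a 0 * (jweight (klFlowDeg n) w * nq i w)) jmeas := (hin i).const_mul _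
      rw [e, integral_add i1 i2, integral_const_mul]
      simp only [hieq, if_true]
      refine add_le_add (mul_le_mul_of_nonneg_left (hN k hk1 hk) (ha_nn 0)) ?_
      rw [hieq] at hsum; exact hsum
    · have e : (fun w => jweight (klFlowDeg n) w * pdef i w) =
          fun w => ∑ l ∈ Finset.Icc 1 (k - i), a l * (jweight (klFlowDeg n) w * mq k i l w) := by
        funext w; rw [epdef i w]; simp only [hieq, if_false, zero_add]
      rw [e]
      simp only [hieq, if_false, zero_add]
      exact hsum
  have hTm : ∫ w, jweight (klFlowDeg n) w * tdef w ∂jmeas ≤ (∑ l ∈ Finset.Ico 1 k, a l * T.Tt k l) + a k * T.Tu k + a (k + 1) * T.Td := by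
    have e : (fun w => jweight (klFlowDeg n) w * tdef w) =
        fun w => (∑ l ∈ Finset.Ico 1 k, a l * (jweight (klFlowDeg n) w * tq k l w)) + a k * (jweight (klFlowDeg n) w * uq k w) +
          a (k + 1) * (jweight (klFlowDeg n) w * dq w) := by
      funext w; simp only [htdef, mul_add, Finset.mul_sum]; ring_nf
    have i1 : Integrable (fun w => ∑ l ∈ Finset.Ico 1 k, a l * (jweight (klFlowDeg n) w * tq k l w)) jmeas :=
      integrable_finsetSum _ fun l _ => (hit k l).const_mul _
    have i2 : Integrable (fun w => a k * (jweight (klFlowDeg n) w * uq k w)) jmeas := (hiu k).const_mul _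
    have i3 : Integrable (fun w => a (k + 1) * (jweight (klFlowDeg n) w * dq w)) jmeas := hid.const_mul _
    have i12 : Integrable (fun w => (∑ l ∈ Finset.Ico 1 k, a l * (jweight (klFlowDeg n) w * tq k l w)) +
        a k * (jweight (klFlowDeg n) w * uq k w)) jmeas := i1.add i2
    rw [e, integral_add i12 i3, integral_add i1 i2, integral_const_mul, integral_const_mul,
      integral_finsetSum _ fun l _ => (hit k l).const_mul _]
    refine add_le_add (add_le_add (Finset.sum_le_sum fun l hl => ?_) (mul_le_mul_of_nonneg_left (hTu k hk1 hk) (ha_nn k)))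
      (mul_le_mul_of_nonneg_left hTd (ha_nn (k + 1)))
    rw [integral_const_mul]
    simp only [Finset.mem_Ico] at hl
    exact mul_le_mul_of_nonneg_left (hTt k l hl.1 hl.2 hk) (ha_nn l)
  have hEm : ∫ w, jweight (klFlowDeg n) w * edef w ∂jmeas ≤ a k * T.N0 := by
    have e : (fun w => jweight (klFlowDeg n) w * edef w) = fun w => a k * (jweight (klFlowDeg n) w * nq 0 w) := by
      funext w; simp only [hedef]; ring
    rw [e, integral_const_mul]
    exact mul_le_mul_of_nonneg_left hN0 (ha_nn k)
  -- the a.e. product / transport / defect majorisations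
  have hak : ∀ x, |iteratedDeriv k g x| ≤ a k := ha k hk1 (hk.trans (by norm_num))
  have hw : ∀ᵐ w ∂jmeas,
      (∀ i, 1 ≤ i → i ≤ k →
        |iteratedDeriv i (fun ϑ : ℝ =>
            klFlatCutoffFn μ (WithLp.ofLp ((WithLp.toLp 2 (klFermiPoint μ K' ϑ) : EuclideanSpace ℝ (Fin 2)) - jshift w))) θ| *
          |iteratedDeriv (k - i) (fun ϑ : ℝ =>
            f (polarAngle (centredRep (WithLp.ofLp ((WithLp.toLp 2 (klFermiPoint μ K' ϑ) : EuclideanSpace ℝ (Fin 2)) - jshift w)))) -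
              klAngularMean f) θ| ≤ pdef i w) ∧
      |klFlatCutoffFn μ (WithLp.ofLp ((WithLp.toLp 2 (klFermiPoint μ K' θ) : EuclideanSpace ℝ (Fin 2)) - jshift w))| *
        |iteratedDeriv k (fun ϑ : ℝ =>
            f (polarAngle (centredRep (WithLp.ofLp ((WithLp.toLp 2 (klFermiPoint μ K' ϑ) : EuclideanSpace ℝ (Fin 2)) - jshift w)))) -
              klAngularMean f) θ -
          iteratedDeriv k (fun ϑ : ℝ => f ϑ - klAngularMean f) θ| ≤ tdef w ∧
      |klFlatCutoffFn μ (WithLp.ofLp ((WithLp.toLp 2 (klFermiPoint μ K' θ) : EuclideanSpace ℝ (Fin 2)) - jshift w)) - 1| *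
        |iteratedDeriv k (fun ϑ : ℝ => f ϑ - klAngularMean f) θ| ≤ edef w := by
    filter_upwards [hae, hchain] with w h1 h2
    obtain ⟨hnq0, hnq, hmq, htq, huq, hdq⟩ := h1
    obtain ⟨-, hgr, htr, -⟩ := h2
    -- the door's expressions are the certificate's objects
    have ecut : (fun ϑ : ℝ => klFlatCutoffFn μ (WithLp.ofLp ((WithLp.toLp 2 (klFermiPoint μ K' ϑ) : EuclideanSpace ℝ (Fin 2)) - jshift w))) =
        certCutoff μ r w := by funext ϑ; rfl
    have eang : (fun ϑ : ℝ => f (polarAngle (centredRep (WithLp.ofLp ((WithLp.toLp 2 (klFermiPoint μ K' ϑ) : EuclideanSpace ℝ (Fin 2)) - jshift w)))) -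
        klAngularMean f) = fun ϑ => g (certAngle r w ϑ) := by funext ϑ; rfl
    have ecut0 : klFlatCutoffFn μ (WithLp.ofLp ((WithLp.toLp 2 (klFermiPoint μ K' θ) : EuclideanSpace ℝ (Fin 2)) - jshift w)) = certCutoff μ r w θ := rfl
    have eg : (fun ϑ : ℝ => f ϑ - klAngularMean f) = g := rfl
    rw [ecut, eang, ecut0, eg]
    refine ⟨?_, ?_, ?_⟩
    · intro i hi1 hik
      by_cases hieq : i = k
      · -- top order: the angular factor enters by its value only
        subst hieq
        have e0 : Finset.Icc 1 (i - i) = ∅ := by rw [Nat.sub_self]; decide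
        simp only [hpdef, if_true, e0, Finset.sum_empty, add_zero]
        rw [Nat.sub_self, iteratedDeriv_zero]
        calc |iteratedDeriv i (certCutoff μ r w) θ| * |g (certAngle r w θ)| ≤ nq i w * a 0 :=
              mul_le_mul (hnq i hi1 hk) (ha0 _) (abs_nonneg _) ((abs_nonneg _).trans (hnq i hi1 hk))
          _ = a 0 * nq i w := mul_comm _ _
      · have hlt : i < k := lt_of_le_of_ne hik hieq
        have hki1 : 1 ≤ k - i := by omega
        have hki4 : k - i ≤ 4 := by omega
        have hg' := hgr (k - i) hki1 hki4
        simp only [hpdef, hieq, if_false, zero_add]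
        calc |iteratedDeriv i (certCutoff μ r w) θ| * |iteratedDeriv (k - i) (fun ϑ => g (certAngle r w ϑ)) θ|
            ≤ |iteratedDeriv i (certCutoff μ r w) θ| * ∑ l ∈ Finset.Icc 1 (k - i), a l * bellP (k - i) l (certAngleJets r w θ) :=
              mul_le_mul_of_nonneg_left hg' (abs_nonneg _)
          _ = ∑ l ∈ Finset.Icc 1 (k - i), a l * (|iteratedDeriv i (certCutoff μ r w) θ| * bellP (k - i) l (certAngleJets r w θ)) := by
              rw [Finset.mul_sum]; refine Finset.sum_congr rfl fun l _ => ?_; ring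
          _ ≤ ∑ l ∈ Finset.Icc 1 (k - i), a l * mq k i l w := Finset.sum_le_sum fun l hl => by
              simp only [Finset.mem_Icc] at hl
              exact mul_le_mul_of_nonneg_left (hmq k i l hi1 hlt hk hl.1 hl.2) (ha_nn l)
    · -- transport
      have h := htr k hk1 hk θ
      have hχ0 : 0 ≤ |certCutoff μ r w θ| := abs_nonneg _
      calc |certCutoff μ r w θ| * |iteratedDeriv k (fun ϑ => g (certAngle r w ϑ)) θ - iteratedDeriv k g θ|
          ≤ |certCutoff μ r w θ| * ((∑ l ∈ Finset.Ico 1 k, a l * bellP k l (certAngleJets r w θ)) +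
              a k * |iteratedDeriv 1 (certAngle r w) θ ^ k - 1| + a (k + 1) * |toIocMod Real.two_pi_pos (-π) (certAngle r w θ - θ)|) :=
            mul_le_mul_of_nonneg_left h hχ0
        _ = (∑ l ∈ Finset.Ico 1 k, a l * (|certCutoff μ r w θ| * bellP k l (certAngleJets r w θ))) +
              a k * (|certCutoff μ r w θ| * |iteratedDeriv 1 (certAngle r w) θ ^ k - 1|) +
              a (k + 1) * (|certCutoff μ r w θ| * |toIocMod Real.two_pi_pos (-π) (certAngle r w θ - θ)|) := by
            rw [mul_add, mul_add, Finset.mul_sum]; congr 1; congr 1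
            · refine Finset.sum_congr rfl fun l _ => ?_; ring
            · ring
            · ring
        _ ≤ tdef w := by
            simp only [htdef]
            refine add_le_add (add_le_add (Finset.sum_le_sum fun l hl => ?_) (mul_le_mul_of_nonneg_left (huq k hk1 hk) (ha_nn k)))
              (mul_le_mul_of_nonneg_left hdq (ha_nn (k + 1)))
            simp only [Finset.mem_Ico] at hl
            exact mul_le_mul_of_nonneg_left (htq k l hl.1 hl.2 hk) (ha_nn l)
    · -- defect
      simp only [hedef]
      calc |certCutoff μ r w θ - 1| * |iteratedDeriv k g θ| ≤ nq 0 w * a k :=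
            mul_le_mul hnq0 (hak θ) (abs_nonneg _) ((abs_nonneg _).trans hnq0)
        _ = a k * nq 0 w := mul_comm _ _
  have hmain := flowPiece_reading_remainder_jets_weightedMoments_ae (L := L) (M := M) β U hμ n K' hf4 hon hang hγ hflat hk θ
    hpint htint heint hw hMx hTm hEm
  refine hmain.trans (le_of_eq ?_)
  have := door_sum_eq_bound T a hk1 hk
  rw [← this]

end Majorants

/-! ## §2 The frame-quantified certificate -/

section Frame

variable {L M : ℕ} [NeZero L] [NeZero M]

/-- **THE (C1) CERTIFICATE CONSUMER, FRAME-QUANTIFIED FORM** (every base angle): `CutoffDefectCertFrame d A T` + frame sizes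
`‖Dʲ(evalM K′)‖ ≤ A j` + the on-curve identity + regularity of `u_{K′}` + the profile data ⟹ `|∂ᵏJ(θ)| ≤ T.bound a k` (`1 ≤ k ≤ 4`). -/
theorem flowPiece_reading_remainder_jets_of_certFrame {d : ℕ} {A : ℕ → ℝ} {T : CutoffDefectTable}
    (hcert : CutoffDefectCertFrame d A T) (β U : ℝ) {μ : ℝ} (hμ : μ ∈ klWindowC) (n : ℕ) (hd : klFlowDeg n = d) (K' : TrigPolyC4v)
    (hA : ∀ j ≤ 4, ∀ p : EuclideanSpace ℝ (Fin 2), ‖iteratedFDeriv ℝ j (fun q : EuclideanSpace ℝ (Fin 2) => K'.eval (WithLp.ofLp q)) p‖ ≤ A j)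
    (hr : ContDiff ℝ 4 (perturbedFermiRadius (fun p => -K'.eval p) μ))
    (hcurve : ∀ ϑ : ℝ, freeBandFn (klFermiPoint μ K' ϑ) - μ = K'.eval (klFermiPoint μ K' ϑ))
    (hf : ContDiff ℝ 5 fun θ : ℝ => klLocalPart L M β U μ (klFlowFrameU L M β U μ n) n θ)
    (hon : ∀ θ, klFrameExtFn μ (fun θ => klLocalPart L M β U μ (klFlowFrameU L M β U μ n) n θ) (klFermiPoint μ K' θ) =
      klLocalPart L M β U μ (klFlowFrameU L M β U μ n) n θ)
    (hang : ∀ θ, klLocalPart L M β U μ (klFlowFrameU L M β U μ n) n (polarAngle (centredRep (klFermiPoint μ K' θ))) =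
      klLocalPart L M β U μ (klFlowFrameU L M β U μ n) n θ)
    {a : ℕ → ℝ} (ha_nn : ∀ l, 0 ≤ a l)
    (ha0 : ∀ x, |klLocalPart L M β U μ (klFlowFrameU L M β U μ n) n x -
      klAngularMean (fun θ => klLocalPart L M β U μ (klFlowFrameU L M β U μ n) n θ)| ≤ a 0)
    (ha : ∀ l, 1 ≤ l → l ≤ 5 → ∀ x, |iteratedDeriv l (fun x => klLocalPart L M β U μ (klFlowFrameU L M β U μ n) n x -
      klAngularMean (fun θ => klLocalPart L M β U μ (klFlowFrameU L M β U μ n) n θ)) x| ≤ a l)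
    (hflat : ∀ ϑ : ℝ, klFlatCutoffFn μ (klFermiPoint μ K' ϑ) = 1)
    {k : ℕ} (hk1 : 1 ≤ k) (hk : k ≤ 4) (θ : ℝ) :
    |iteratedDeriv k (fun θ => klLocalPart L M β U μ (klFlowFrameU L M β U μ n) n θ -
        (klFlowPiece L M β U μ n).eval (klFermiPoint μ K' θ)) θ| ≤ T.bound a k := by
  subst hd
  set J : ℝ → ℝ := fun θ => klLocalPart L M β U μ (klFlowFrameU L M β U μ n) n θ - (klFlowPiece L M β U μ n).eval (klFermiPoint μ K' θ)
    with hJ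
  have hJper : Function.Periodic J (2 * π) := fun x => by
    simp only [hJ, klLocalPart_periodic β U μ _ n x, klFermiPoint_add_two_pi]
  set θ₀ := toIocMod Real.two_pi_pos (-π) θ with hθ₀
  obtain ⟨mz, hm⟩ : ∃ m : ℤ, θ = θ₀ + m • (2 * π) :=
    ⟨toIocDiv Real.two_pi_pos (-π) θ, (toIocMod_add_toIocDiv_zsmul Real.two_pi_pos (-π) θ).symm⟩
  have hθ₀mem : θ₀ ∈ Set.Icc (-π) π := by
    have h := toIocMod_mem_Ioc Real.two_pi_pos (-π) θ
    exact ⟨h.1.le, by linarith [h.2]⟩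
  have hshift : iteratedDeriv k J θ = iteratedDeriv k J θ₀ := by
    rw [hm]; exact (iteratedDeriv_periodic hJper k).zsmul mz θ₀
  rw [hshift]
  exact flowPiece_reading_remainder_jets_of_majorants (L := L) (M := M) T β U hμ n K' hf hon hang ha_nn ha0 ha hr hflat hk1 hk θ₀
    (hcert μ hμ K' hA hr hcurve θ₀ hθ₀mem)

end Frame

end Summit.HubbardSuperconductivity.HubbardSuperconductivity.Theorems.KLRegimeSplit

end
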